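import Mathlib.NumberTheory.Chebyshev
import Mathlib.Analysis.Asymptotics.AsymptoticEquivalent
import Mathlib.Analysis.SpecialFunctions.Log.Basic
import Literature.NumberTheory.LFunctions.RHWave0PNTProofs
import HarnessLib

/-!
# [GenEll] Lemma 4.1 (The Existence of Primes of Prescribed Size) and Remark 4.1.1 — PROVED

S. Mochizuki, *Arithmetic elliptic curves in general position*, Math. J. Okayama Univ. 52 (2010)
[cite: MochizukiGenEll2010] (kurims manuscript, Feb. 2009), §4 "Primes of Prescribed Size",
Lemma 4.1 pp. 20–21 and Remark 4.1.1 p. 21, read on the page (abc-iut campaign S; DAG nodes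
`GenEll:Lem4.1(i)`, `GenEll:Lem4.1(ii)`, `GenEll:Rmk4.1.1(i)`; seat abc-iut-S-d3):

> **Lemma 4.1.** Write `ℝ'_{>0} ⊆ ℝ_{>0}` for the complement in `ℝ_{>0}` of the set of prime numbers;
> `θ(x) := Σ_{p < x} log(p)` — where the sum is over prime numbers `p < x` — for `x ∈ ℝ'_{>0}`. Let
> `M` be a positive integer; `ε, x_ε, C_ε ∈ ℝ_{>0}` such that `0 < ε < 1/4`, `ε·x_ε > C_ε`, and,
> moreover, we have:
> (i) `(5/4)·x + C_ε > θ(x)`, for all `x ∈ ℝ'_{>0}`; `θ(x) > (1 − ε)x`, for all `x ∈ ℝ'_{>0}` such that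
> `x ≥ x_ε`;
> (ii) `M·log(x) ≤ ε·x`, for all `x ∈ ℝ_{>0}` such that `x ≥ x_ε`.
> Also, let us write `x_A := Σ_{p ∈ A} log(p)` for any finite set of prime numbers `A`. Then for any
> nonnegative `h ∈ ℝ` and any finite set of prime numbers `A` such that `x_A > x_ε`, there exist `M`
> distinct prime numbers `p_1, …, p_M` such that `p_j ∉ A`, and `h ≤ p_j ≤ (1 + 6ε)·x_A + 8h`, for
> `j = 1, …, M`.
>
> **Remark 4.1.1.** The issue of finding `ε, x_ε, C_ε` which satisfy condition (ii) of Lemma 4.1 is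
> entirely elementary. On the other hand, with regard to condition (i), the fact that `θ(x)/x → 1`
> as `x → ∞` is a well-known consequence of the prime number theorem […].

## Rendering

* The paper's `θ(x) = Σ_{p<x} log p` (STRICT inequality — it differs from Mathlib's Chebyshev
  `θ(x) = Σ_{p≤x} log p` exactly at prime `x`) is written with Mathlib's `Nat.primesBelow`:
  `Σ_{p ∈ primesBelow ⌈x⌉₊} log p` (for a natural number `p`, `p < x ↔ p < ⌈x⌉₊`, `Nat.lt_ceil`), written
  out in full in every statement (abbreviated `ϑ(x)` in the docstrings). No definition is introduced
  (theorems only).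
* "`x ∈ ℝ'_{>0}`" (a positive real which is not a prime number) is `0 < x ∧ ∀ p prime, (p : ℝ) ≠ x`;
  hypotheses (i) are assumed ONLY there, exactly as printed. The printed proof's closing remark
  ("we may assume … `y_A, (1+δ)h ∈ ℝ'_{>0}`, for instance by replacing `δ`, `h` by real numbers
  slightly greater") is implemented by evaluating (i) at NON-INTEGER points squeezed between
  consecutive integers (`Σ_{p ≤ y} log p = ϑ(t)` for `⌊y⌋ < t < ⌊y⌋+1`, `t ≥ y`; `Σ_{p<h} log p = ϑ(s)`
  for `⌈h⌉−1 < s < h`), so no perturbation of `δ`, `h` is needed.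
* "`M` distinct prime numbers `p_1, …, p_M`" = a `Finset ℕ` of cardinality `M` consisting of primes.
  The hypothesis that `A` consists of primes is not needed for the conclusion and is dropped
  (`x_A := Σ_{p∈A} log p` for any finite `A ⊆ ℕ`); `M = 0` is (trivially) allowed.
* `lemma41` is Lemma 4.1 verbatim; `remark411` is Remark 4.1.1 made into a theorem: for every
  `M` and every `ε > 0` there EXIST `x_ε, C_ε > 0` with `ε·x_ε > C_ε`, (i) (even at all `x > 0`,
  resp. all `x ≥ x_ε`) and (ii) — from the prime number theorem in the form `θ(x) ~ x` PROVED in the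
  tree (`Literature.NumberTheory.LFunctions.chebyshevTheta_isEquivalent`) and `log x = o(x)`
  (Mathlib `Real.isLittleO_log_id_atTop`); `lemma41_unconditional` combines the two.

Deliberately NOT here: Lemma 4.2, Corollaries 4.3/4.4 (they rest on Thm. 3.8); the [IUTchIV]
Prop. 2.1 (ii) form of the same estimate is `Literature.IUT.LogVolume.exists_prime_not_mem_le_of_isXiPrm`.
-/

noncomputable section

open Real Filter Finset Asymptotics
open scoped Chebyshev

namespace Literature.NumberTheory.DiophantineGeometry.GenEll

/-! ## `ϑ` versus Mathlib's Chebyshev `θ` -/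

/-- `(∑ p ∈ Nat.primesBelow ⌈x⌉₊, Real.log (p : ℝ)) = Σ_{p<x} log p ≥ 0`. [cite: MochizukiGenEll2010, Lem 4.1 p.20] -/
theorem thetaLt_nonneg (x : ℝ) : 0 ≤ (∑ p ∈ Nat.primesBelow ⌈x⌉₊, Real.log (p : ℝ)) :=
  Finset.sum_nonneg fun p _ => Real.log_natCast_nonneg p

/-- `Σ_{p<x} log p ≤ Σ_{p≤x} log p`: the paper's `θ` is at most Mathlib's Chebyshev `θ`.
[cite: MochizukiGenEll2010, Lem 4.1 p.20] -/
theorem thetaLt_le_theta (x : ℝ) : (∑ p ∈ Nat.primesBelow ⌈x⌉₊, Real.log (p : ℝ)) ≤ θ x := by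
  rw [Chebyshev.theta_eq_sum_primesLE]
  refine Finset.sum_le_sum_of_subset_of_nonneg (fun p hp => ?_)
    (fun p _ _ => Real.log_natCast_nonneg p)
  rw [Nat.mem_primesBelow] at hp
  rw [Nat.mem_primesLE]
  exact ⟨Nat.le_floor (le_of_lt (Nat.lt_ceil.mp hp.1)), hp.2⟩

/-- `Σ_{p ≤ x−1} log p ≤ Σ_{p<x} log p`: Mathlib's `θ(x − 1)` is at most the paper's `θ(x)`.
[cite: MochizukiGenEll2010, Lem 4.1 p.20] -/
theorem theta_sub_one_le_thetaLt (x : ℝ) : θ (x - 1) ≤ (∑ p ∈ Nat.primesBelow ⌈x⌉₊, Real.log (p : ℝ)) := by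
  rw [Chebyshev.theta_eq_sum_primesLE]
  refine Finset.sum_le_sum_of_subset_of_nonneg (fun p hp => ?_)
    (fun p _ _ => Real.log_natCast_nonneg p)
  rw [Nat.mem_primesLE] at hp
  rw [Nat.mem_primesBelow]
  refine ⟨Nat.lt_ceil.mpr ?_, hp.2⟩
  rcases lt_or_ge (x - 1) 0 with hx | hx
  · rw [Nat.floor_of_nonpos hx.le] at hp
    exact absurd hp.2 (by rw [Nat.le_zero.mp hp.1]; exact Nat.not_prime_zero)
  · have h1 : (p : ℝ) ≤ x - 1 := (Nat.le_floor_iff hx).mp hp.1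
    linarith

/-! ## The two evaluation tricks ("we may assume … `∈ ℝ'_{>0}`") -/

/-- A real strictly between two consecutive natural numbers is not (the cast of) a prime number —
indeed not a natural number at all. [folklore] -/
private theorem natCast_ne_of_mem_Ioo {n : ℕ} {t : ℝ} (h1 : (n : ℝ) < t) (h2 : t < (n : ℝ) + 1) (p : ℕ) :
    (p : ℝ) ≠ t := by
  intro hpt
  rw [← hpt] at h1 h2
  have h1' : n < p := by exact_mod_cast h1
  have h2' : p < n + 1 := by exact_mod_cast h2
  omega

/-- `Σ_{p ≤ y} log p = (∑ p ∈ Nat.primesBelow ⌈t⌉₊, Real.log (p : ℝ))` for `⌊y⌋ < t ≤ ⌊y⌋ + 1` (the primes `< t` are the primes `≤ y`).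
[cite: MochizukiGenEll2010, Lem 4.1 proof p.21] -/
theorem thetaLt_eq_sum_primesLE_floor {y t : ℝ} (h1 : (⌊y⌋₊ : ℝ) < t) (h2 : t ≤ (⌊y⌋₊ : ℝ) + 1) :
    (∑ p ∈ Nat.primesBelow ⌈t⌉₊, Real.log (p : ℝ)) = ∑ p ∈ Nat.primesLE ⌊y⌋₊, Real.log (p : ℝ) := by
  have hceil : ⌈t⌉₊ = ⌊y⌋₊ + 1 := by
    rw [Nat.ceil_eq_iff (show ⌊y⌋₊ + 1 ≠ 0 by omega)]
    refine ⟨by simpa using h1, ?_⟩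
    push_cast
    exact h2
  rw [hceil]
  rfl

/-! ## Lemma 4.1 -/

/-- **[GenEll] Lemma 4.1 (The Existence of Primes of Prescribed Size)**, verbatim (see the module
docstring for the rendering): with `θ(x) = Σ_{p<x} log p`, `0 < ε < 1/4`, `ε·x_ε > C_ε`, hypotheses
(i) at the positive non-prime reals and (ii) at the reals `≥ x_ε`, for every `h ≥ 0` and every finite
`A` with `x_A = Σ_{p∈A} log p > x_ε` there are `M` distinct primes `p ∉ A` with
`h ≤ p ≤ (1 + 6ε)·x_A + 8h`. PROVED (the printed argument: otherwise all primes in `[h, y_A]`,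
`y_A = (1+6ε)x_A + 8h`, lie in `A` with `≤ M − 1` exceptions, whence
`x_A ≥ θ(y_A) − θ(h) − (M−1) log y_A ≥ (1−2ε)y_A − (5/4)h − C_ε ≥ x_A + (ε x_A − C_ε) + (11/4)h > x_A`).
[cite: MochizukiGenEll2010, Lem 4.1 p.20] -/
theorem lemma41 {M : ℕ} {ε xε Cε : ℝ} (hε : 0 < ε) (hε4 : ε < 1 / 4) (hCε : 0 < Cε)
    (hεx : Cε < ε * xε)
    (hi₁ : ∀ x : ℝ, 0 < x → (∀ p : ℕ, p.Prime → (p : ℝ) ≠ x) → (∑ p ∈ Nat.primesBelow ⌈x⌉₊, Real.log (p : ℝ)) < 5 / 4 * x + Cε)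
    (hi₂ : ∀ x : ℝ, 0 < x → (∀ p : ℕ, p.Prime → (p : ℝ) ≠ x) → xε ≤ x → (1 - ε) * x < (∑ p ∈ Nat.primesBelow ⌈x⌉₊, Real.log (p : ℝ)))
    (hii : ∀ x : ℝ, 0 < x → xε ≤ x → (M : ℝ) * Real.log x ≤ ε * x)
    {h : ℝ} (hh : 0 ≤ h) (A : Finset ℕ) (hxA : xε < ∑ q ∈ A, Real.log (q : ℝ)) :
    ∃ P : Finset ℕ, P.card = M ∧ ∀ p ∈ P, p.Prime ∧ p ∉ A ∧ h ≤ (p : ℝ) ∧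
      (p : ℝ) ≤ (1 + 6 * ε) * (∑ q ∈ A, Real.log (q : ℝ)) + 8 * h := by
  classical
  set xA : ℝ := ∑ q ∈ A, Real.log (q : ℝ) with hxA_def
  set y : ℝ := (1 + 6 * ε) * xA + 8 * h with hy_def
  have hxε : 0 < xε := by
    by_contra hcon
    push Not at hcon
    have : ε * xε ≤ 0 := mul_nonpos_of_nonneg_of_nonpos hε.le hcon
    linarith
  have hxA0 : 0 < xA := hxε.trans hxA
  have hyxA : xA ≤ y := by rw [hy_def]; nlinarith [mul_pos hε hxA0]
  have hy0 : 0 < y := hxA0.trans_le hyxA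
  have hyε : xε ≤ y := (hxA.trans_le hyxA).le
  have hhy : h ≤ y := by rw [hy_def]; nlinarith [mul_pos hε hxA0]
  -- the primes `≤ y`, the primes `< h`, and the primes in `[h, y]`
  set T : Finset ℕ := Nat.primesLE ⌊y⌋₊ with hT_def
  set U : Finset ℕ := Nat.primesBelow ⌈h⌉₊ with hU_def
  set S : Finset ℕ := T.filter (fun p => h ≤ (p : ℝ)) with hS_def
  have hUT : U ⊆ T := by
    intro p hp
    rw [hU_def, Nat.mem_primesBelow] at hp
    rw [hT_def, Nat.mem_primesLE]
    exact ⟨Nat.le_floor ((le_of_lt (Nat.lt_ceil.mp hp.1)).trans hhy), hp.2⟩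
  have hSTU : S = T \ U := by
    ext p
    rw [hS_def, Finset.mem_filter, Finset.mem_sdiff, hU_def, Nat.mem_primesBelow, hT_def,
      Nat.mem_primesLE]
    constructor
    · rintro ⟨hpT, hhp⟩
      refine ⟨hpT, fun hpU => ?_⟩
      have := Nat.lt_ceil.mp hpU.1
      linarith
    · rintro ⟨hpT, hpU⟩
      refine ⟨hpT, ?_⟩
      by_contra hlt
      push Not at hlt
      exact hpU ⟨Nat.lt_ceil.mpr hlt, hpT.2⟩
  -- it suffices to find `M` primes in `S ∖ A`
  suffices hcard : M ≤ (S \ A).card by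
    obtain ⟨P, hPS, hPcard⟩ := Finset.exists_subset_card_eq hcard
    refine ⟨P, hPcard, fun p hp => ?_⟩
    have hp' := hPS hp
    rw [Finset.mem_sdiff, hS_def, Finset.mem_filter, hT_def, Nat.mem_primesLE] at hp'
    obtain ⟨⟨⟨hple, hpprime⟩, hhp⟩, hpA⟩ := hp'
    refine ⟨hpprime, hpA, hhp, ?_⟩
    have : (p : ℝ) ≤ (⌊y⌋₊ : ℝ) := by exact_mod_cast hple
    exact this.trans (Nat.floor_le hy0.le)
  by_contra hlt
  push Not at hlt
  -- (1) counting: `Σ_{p ∈ S} log p ≤ x_A + (M − 1)·log⁺ y ≤ x_A + ε·y`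
  have hlogp : ∀ p ∈ S \ A, Real.log (p : ℝ) ≤ max (Real.log y) 0 := by
    intro p hp
    rw [Finset.mem_sdiff, hS_def, Finset.mem_filter, hT_def, Nat.mem_primesLE] at hp
    obtain ⟨⟨⟨hple, hpprime⟩, -⟩, -⟩ := hp
    have hp0 : (0 : ℝ) < p := by exact_mod_cast hpprime.pos
    have hpy : (p : ℝ) ≤ y := le_trans (by exact_mod_cast hple) (Nat.floor_le hy0.le)
    exact (Real.log_le_log hp0 hpy).trans (le_max_left _ _)
  have hsum_sdiff : ∑ p ∈ S \ A, Real.log (p : ℝ) ≤ (M : ℝ) * max (Real.log y) 0 := by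
    have h1 := Finset.sum_le_card_nsmul (S \ A) (fun p : ℕ => Real.log (p : ℝ)) _ hlogp
    rw [nsmul_eq_mul] at h1
    refine h1.trans (mul_le_mul_of_nonneg_right ?_ (le_max_right _ _))
    exact_mod_cast hlt.le
  have hsum_inter : ∑ p ∈ S ∩ A, Real.log (p : ℝ) ≤ xA :=
    Finset.sum_le_sum_of_subset_of_nonneg Finset.inter_subset_right
      (fun p _ _ => Real.log_natCast_nonneg p)
  have hsumS : ∑ p ∈ S, Real.log (p : ℝ) =
      ∑ p ∈ S \ A, Real.log (p : ℝ) + ∑ p ∈ S ∩ A, Real.log (p : ℝ) := by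
    rw [← Finset.sum_sdiff (Finset.inter_subset_left (s₁ := S) (s₂ := A)),
      Finset.sdiff_inter_self_left]
  have hMlog : (M : ℝ) * max (Real.log y) 0 ≤ ε * y := by
    rcases le_or_gt (Real.log y) 0 with hly | hly
    · rw [max_eq_right hly, mul_zero]
      exact (mul_pos hε hy0).le
    · rw [max_eq_left hly.le]
      exact hii y hy0 hyε
  have hS_le : ∑ p ∈ S, Real.log (p : ℝ) ≤ xA + ε * y := by
    rw [hsumS]; linarith
  -- (2) `Σ_{p ∈ S} = Σ_{p ≤ y} − Σ_{p < h}`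
  have hS_eq : ∑ p ∈ S, Real.log (p : ℝ) =
      ∑ p ∈ T, Real.log (p : ℝ) - ∑ p ∈ U, Real.log (p : ℝ) := by
    rw [hSTU, ← Finset.sum_sdiff hUT]
    ring
  -- (3) lower bound `Σ_{p ≤ y} log p > (1 − ε)·y`, evaluating (i) at `t`, `⌊y⌋ < t < ⌊y⌋ + 1`, `t ≥ y`
  have hT_ge : (1 - ε) * y < ∑ p ∈ T, Real.log (p : ℝ) := by
    set t : ℝ := (y + ((⌊y⌋₊ : ℝ) + 1)) / 2 with ht_def
    have hfl : (⌊y⌋₊ : ℝ) ≤ y := Nat.floor_le hy0.le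
    have hfl1 : y < (⌊y⌋₊ : ℝ) + 1 := Nat.lt_floor_add_one y
    have ht1 : (⌊y⌋₊ : ℝ) < t := by rw [ht_def]; linarith
    have ht2 : t < (⌊y⌋₊ : ℝ) + 1 := by rw [ht_def]; linarith
    have hty : y ≤ t := by rw [ht_def]; linarith
    have ht0 : 0 < t := hy0.trans_le hty
    have hteq := thetaLt_eq_sum_primesLE_floor ht1 ht2.le
    have hi := hi₂ t ht0 (fun p _ => natCast_ne_of_mem_Ioo ht1 ht2 p) (hyε.trans hty)
    rw [hteq, ← hT_def] at hi
    have h1ε : 0 ≤ 1 - ε := by linarith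
    calc (1 - ε) * y ≤ (1 - ε) * t := mul_le_mul_of_nonneg_left hty h1ε
      _ < _ := hi
  -- (4) upper bound `Σ_{p < h} log p < (5/4)·h + C_ε`, evaluating (i) at `s`, `⌈h⌉ − 1 < s < h`
  have hU_le : ∑ p ∈ U, Real.log (p : ℝ) < 5 / 4 * h + Cε := by
    rcases Nat.eq_zero_or_pos ⌈h⌉₊ with h0 | hpos
    · -- `h = 0`: no primes `< h`
      rw [hU_def, h0, Nat.primesBelow_zero, Finset.sum_empty]
      positivity
    · obtain ⟨n, hn⟩ : ∃ n : ℕ, ⌈h⌉₊ = n + 1 := ⟨⌈h⌉₊ - 1, by omega⟩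
      have hn' : (n : ℝ) < h ∧ h ≤ (n : ℝ) + 1 := by
        have h12 := (Nat.ceil_eq_iff (show n + 1 ≠ 0 by omega)).mp hn
        refine ⟨by simpa using h12.1, ?_⟩
        have h2 := h12.2
        push_cast at h2
        exact h2
      obtain ⟨hn1, hn2⟩ := hn'
      set s : ℝ := (h + n) / 2 with hs_def
      have hs1 : (n : ℝ) < s := by rw [hs_def]; linarith
      have hs2 : s < h := by rw [hs_def]; linarith
      have hs3 : s < (n : ℝ) + 1 := by linarith
      have hs0 : 0 < s := lt_of_le_of_lt (Nat.cast_nonneg n) hs1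
      have hceil : ⌈s⌉₊ = n + 1 := by
        rw [Nat.ceil_eq_iff (show n + 1 ≠ 0 by omega)]
        refine ⟨by simpa using hs1, ?_⟩
        push_cast
        exact hs3.le
      have hi := hi₁ s hs0 (fun p _ => natCast_ne_of_mem_Ioo hs1 hs3 p)
      rw [hceil, ← hn, ← hU_def] at hi
      linarith
  -- (5) the contradiction
  have hmain : (1 - 2 * ε) * y - 5 / 4 * h - Cε < xA := by
    have := hS_eq ▸ hS_le
    linarith
  have hkey : xA + (ε * xA - Cε) ≤ (1 - 2 * ε) * y - 5 / 4 * h - Cε := by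
    rw [hy_def]
    nlinarith [mul_pos hε hxA0, mul_nonneg hε.le hh]
  have hεxA : Cε < ε * xA := hεx.trans (mul_lt_mul_of_pos_left hxA hε)
  linarith

/-! ## Remark 4.1.1: the parameters exist (prime number theorem) -/

/-- **[GenEll] Remark 4.1.1**, as a theorem: for every `M` and every `ε > 0` there exist
`x_ε, C_ε > 0` with `ε·x_ε > C_ε` satisfying (i) — `(5/4)x + C_ε > θ(x)` for ALL `x > 0` and
`θ(x) > (1−ε)x` for ALL `x ≥ x_ε` (so in particular on `ℝ'_{>0}`) — and (ii) `M log x ≤ ε x` for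
`x ≥ x_ε`; here `θ(x) = Σ_{p<x} log p`. (i) is "a well-known consequence of the prime number theorem"
— used here in the PROVED form `θ ~ x` (`Literature.NumberTheory.LFunctions.chebyshevTheta_isEquivalent`);
(ii) is `log x = o(x)`. [cite: MochizukiGenEll2010, Rmk 4.1.1 p.21] -/
theorem remark411 (M : ℕ) {ε : ℝ} (hε : 0 < ε) :
    ∃ xε Cε : ℝ, 0 < xε ∧ 0 < Cε ∧ Cε < ε * xε ∧
      (∀ x : ℝ, 0 < x → (∑ p ∈ Nat.primesBelow ⌈x⌉₊, Real.log (p : ℝ)) < 5 / 4 * x + Cε) ∧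
      (∀ x : ℝ, xε ≤ x → (1 - ε) * x < (∑ p ∈ Nat.primesBelow ⌈x⌉₊, Real.log (p : ℝ))) ∧
      (∀ x : ℝ, xε ≤ x → (M : ℝ) * Real.log x ≤ ε * x) := by
  have hPNT := Literature.NumberTheory.LFunctions.chebyshevTheta_isEquivalent
  -- upper bound: `θ x ≤ (5/4) x` for `x ≥ a`
  have hup := hPNT.isLittleO.bound (show (0 : ℝ) < 1 / 4 by norm_num)
  rw [Filter.eventually_atTop] at hup
  obtain ⟨a, ha⟩ := hup
  -- lower bound: `θ x ≥ (1 − ε/2) x` for `x ≥ b`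
  have hlow := hPNT.isLittleO.bound (show (0 : ℝ) < ε / 2 by positivity)
  rw [Filter.eventually_atTop] at hlow
  obtain ⟨b, hb⟩ := hlow
  -- `log x ≤ (ε/(M+1)) x` for `x ≥ c`
  have hlog := Real.isLittleO_log_id_atTop.bound (show (0 : ℝ) < ε / (M + 1) by positivity)
  rw [Filter.eventually_atTop] at hlog
  obtain ⟨c, hc⟩ := hlog
  set Cε : ℝ := θ (max a 0) + 1 with hCε_def
  have hCε : 0 < Cε := by
    have := Chebyshev.theta_nonneg (max a 0)
    rw [hCε_def]; linarith
  set xε : ℝ := max (max (b + 1) (2 / ε + 1)) (max (max c 1) (Cε / ε + 1)) with hxε_def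
  have hxb : b + 1 ≤ xε := le_trans (le_max_left _ _) (le_max_left _ _)
  have hx2ε : 2 / ε + 1 ≤ xε := le_trans (le_max_right _ _) (le_max_left _ _)
  have hxc : c ≤ xε := le_trans (le_trans (le_max_left _ _) (le_max_left _ _)) (le_max_right _ _)
  have hx1 : 1 ≤ xε := le_trans (le_trans (le_max_right _ _) (le_max_left _ _)) (le_max_right _ _)
  have hxC : Cε / ε + 1 ≤ xε := le_trans (le_max_right _ _) (le_max_right _ _)
  refine ⟨xε, Cε, by linarith, hCε, ?_, fun x hx => ?_, fun x hx => ?_, fun x hx => ?_⟩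
  · -- `C_ε < ε x_ε`
    have h1 : ε * (Cε / ε + 1) ≤ ε * xε := mul_le_mul_of_nonneg_left hxC hε.le
    have h2 : ε * (Cε / ε + 1) = Cε + ε := by field_simp
    linarith
  · -- (i), first part, at every `x > 0`
    have hθ := thetaLt_le_theta x
    rcases lt_or_ge x a with hxa | hxa
    · have hmono : θ x ≤ θ (max a 0) := Chebyshev.theta_mono (le_trans hxa.le (le_max_left _ _))
      have : (0 : ℝ) < 5 / 4 * x := by positivity
      rw [hCε_def]; linarith
    · have h := ha x hxa
      simp only [Pi.sub_apply, Real.norm_eq_abs, abs_of_pos hx] at h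
      have h' : θ x - x ≤ 1 / 4 * x := le_trans (le_abs_self _) h
      linarith
  · -- (i), second part, at every `x ≥ x_ε`: `(∑ p ∈ Nat.primesBelow ⌈x⌉₊, Real.log (p : ℝ)) ≥ θ(x − 1) ≥ (1 − ε/2)(x − 1) > (1 − ε) x`
    have hθ := theta_sub_one_le_thetaLt x
    have hxb' : b ≤ x - 1 := by linarith
    have hx0 : 0 ≤ x - 1 := by linarith
    have h := hb (x - 1) hxb'
    simp only [Pi.sub_apply, Real.norm_eq_abs, abs_of_nonneg hx0] at h
    have h' : -(θ (x - 1) - (x - 1)) ≤ ε / 2 * (x - 1) := le_trans (neg_le_abs _) h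
    -- `(ε/2)·x > 1` since `x ≥ 2/ε + 1`
    have hεx : 1 < ε / 2 * x := by
      have h1 : 2 / ε + 1 ≤ x := hx2ε.trans hx
      have h2 : ε / 2 * (2 / ε + 1) ≤ ε / 2 * x := mul_le_mul_of_nonneg_left h1 (by positivity)
      have h3 : ε / 2 * (2 / ε + 1) = 1 + ε / 2 := by field_simp
      linarith
    nlinarith
  · -- (ii) at every `x ≥ x_ε`: `M log x ≤ M·(ε/(M+1))·x ≤ ε x`
    have hx0 : 0 < x := lt_of_lt_of_le (by linarith) hx
    have h := hc x (hxc.trans hx)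
    simp only [id_eq, Real.norm_eq_abs, abs_of_pos hx0] at h
    have hlogle : Real.log x ≤ ε / (M + 1) * x := le_trans (le_abs_self _) h
    have hM0 : (0 : ℝ) ≤ M := Nat.cast_nonneg M
    have h1 : (M : ℝ) * Real.log x ≤ M * (ε / (M + 1) * x) := mul_le_mul_of_nonneg_left hlogle hM0
    have h2 : (M : ℝ) * (ε / (M + 1) * x) ≤ ε * x := by
      rw [show (M : ℝ) * (ε / (M + 1) * x) = (M / (M + 1)) * (ε * x) by ring]
      have hfrac : (M : ℝ) / (M + 1) ≤ 1 := by
        rw [div_le_one (by positivity)]; linarith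
      have hεx0 : 0 ≤ ε * x := by positivity
      nlinarith
    exact h1.trans h2

/-- **[GenEll] Lemma 4.1 with the parameters of Remark 4.1.1 supplied** (unconditional form): for
every `M` and `0 < ε < 1/4` there is a threshold `x_ε > 0` such that for every `h ≥ 0` and every
finite `A ⊆ ℕ` with `x_A = Σ_{p∈A} log p > x_ε` there are `M` distinct primes `p ∉ A` with
`h ≤ p ≤ (1+6ε)·x_A + 8h`. [cite: MochizukiGenEll2010, Lem 4.1 p.20] -/
theorem lemma41_unconditional (M : ℕ) {ε : ℝ} (hε : 0 < ε) (hε4 : ε < 1 / 4) :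
    ∃ xε : ℝ, 0 < xε ∧ ∀ (h : ℝ), 0 ≤ h → ∀ A : Finset ℕ, xε < ∑ q ∈ A, Real.log (q : ℝ) →
      ∃ P : Finset ℕ, P.card = M ∧ ∀ p ∈ P, p.Prime ∧ p ∉ A ∧ h ≤ (p : ℝ) ∧
        (p : ℝ) ≤ (1 + 6 * ε) * (∑ q ∈ A, Real.log (q : ℝ)) + 8 * h := by
  obtain ⟨xε, Cε, hxε, hCε, hεx, hi₁, hi₂, hii⟩ := remark411 M hε
  exact ⟨xε, hxε, fun h hh A hxA =>
    lemma41 hε hε4 hCε hεx (fun x hx _ => hi₁ x hx) (fun x _ _ hxε' => hi₂ x hxε')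
      (fun x _ hx => hii x hx) hh A hxA⟩

/-- **[GenEll] Lemma 4.1, absolute form** ("by enlarging `S` [and possibly increasing the
`C`], we may always assume that `x_ε ≤ x_S`", proof of Cor. 4.3, p. 23): for every `M` and
`0 < ε < 1/4` there is a constant `C ≥ 0` such that for EVERY `h ≥ 0` and EVERY finite `A ⊆ ℕ`
there are `M` distinct primes `p ∉ A` with `h ≤ p ≤ (1+6ε)·x_A + 8h + C` — no threshold on
`x_A` (apply `lemma41_unconditional` to `A ∪ P₀` for a fixed finite set of primes `P₀` with
`x_{P₀} > x_ε`; `C = (1+6ε)·x_{P₀}`). [cite: MochizukiGenEll2010, Lem 4.1 p.20, proof of Cor. 4.3 p.23] -/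
theorem lemma41_absolute (M : ℕ) {ε : ℝ} (hε : 0 < ε) (hε4 : ε < 1 / 4) :
    ∃ C : ℝ, 0 ≤ C ∧ ∀ (h : ℝ), 0 ≤ h → ∀ A : Finset ℕ,
      ∃ P : Finset ℕ, P.card = M ∧ ∀ p ∈ P, p.Prime ∧ p ∉ A ∧ h ≤ (p : ℝ) ∧
        (p : ℝ) ≤ (1 + 6 * ε) * (∑ q ∈ A, Real.log (q : ℝ)) + 8 * h + C := by
  classical
  obtain ⟨xε, hxε, H⟩ := lemma41_unconditional M hε hε4
  -- a fixed finite set of primes `P₀` with `x_{P₀} > x_ε`, from `θ(x) > x/2` for large `x`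
  obtain ⟨x₁, -, hx₁, -, -, -, hlow, -⟩ := remark411 0 (show (0 : ℝ) < 1 / 2 by norm_num)
  set x : ℝ := max x₁ (2 * xε + 1) with hx_def
  set P₀ : Finset ℕ := Nat.primesBelow ⌈x⌉₊ with hP₀_def
  have hP₀ : xε < ∑ q ∈ P₀, Real.log (q : ℝ) := by
    have h1 := hlow x (le_max_left _ _)
    have h2 : 2 * xε + 1 ≤ x := le_max_right _ _
    rw [hP₀_def]
    linarith
  have hlog_nonneg : ∀ q : ℕ, 0 ≤ Real.log (q : ℝ) := fun q => Real.log_natCast_nonneg q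
  refine ⟨(1 + 6 * ε) * ∑ q ∈ P₀, Real.log (q : ℝ),
    mul_nonneg (by linarith) (Finset.sum_nonneg fun q _ => hlog_nonneg q), ?_⟩
  intro h hh A
  have hsub : ∑ q ∈ P₀, Real.log (q : ℝ) ≤ ∑ q ∈ A ∪ P₀, Real.log (q : ℝ) :=
    Finset.sum_le_sum_of_subset_of_nonneg Finset.subset_union_right
      (fun q _ _ => hlog_nonneg q)
  have hunion : ∑ q ∈ A ∪ P₀, Real.log (q : ℝ) ≤
      ∑ q ∈ A, Real.log (q : ℝ) + ∑ q ∈ P₀, Real.log (q : ℝ) := by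
    rw [← Finset.sum_union_inter]
    have := Finset.sum_nonneg fun q (_ : q ∈ A ∩ P₀) => hlog_nonneg q
    linarith
  obtain ⟨P, hPcard, hP⟩ := H h hh (A ∪ P₀) (lt_of_lt_of_le hP₀ hsub)
  refine ⟨P, hPcard, fun p hp => ?_⟩
  obtain ⟨hprime, hnot, hhp, hle⟩ := hP p hp
  refine ⟨hprime, fun hA => hnot (Finset.mem_union_left _ hA), hhp, ?_⟩
  have h16 : (0 : ℝ) ≤ 1 + 6 * ε := by linarith
  calc (p : ℝ) ≤ (1 + 6 * ε) * (∑ q ∈ A ∪ P₀, Real.log (q : ℝ)) + 8 * h := hle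
    _ ≤ (1 + 6 * ε) * (∑ q ∈ A, Real.log (q : ℝ) + ∑ q ∈ P₀, Real.log (q : ℝ)) + 8 * h := by
        gcongr
    _ = (1 + 6 * ε) * (∑ q ∈ A, Real.log (q : ℝ)) + 8 * h +
        (1 + 6 * ε) * ∑ q ∈ P₀, Real.log (q : ℝ) := by ring

/-- **[GenEll] Lemma 4.1 as applied in Cor. 4.3 / 4.4** ("we apply Lemma 4.1 by taking `M` to be
`1`, `1 + 6ε` to be `2`"): there is `C ≥ 0` such that for every `h ≥ 0` and every finite `A ⊆ ℕ`
there is a prime `l ∉ A` with `h ≤ l ≤ 2·x_A + 8h + C`.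
[cite: MochizukiGenEll2010, Lem 4.1 p.20, proof of Cor. 4.3 p.23] -/
theorem exists_prime_notMem_le :
    ∃ C : ℝ, 0 ≤ C ∧ ∀ (h : ℝ), 0 ≤ h → ∀ A : Finset ℕ,
      ∃ l : ℕ, l.Prime ∧ l ∉ A ∧ h ≤ (l : ℝ) ∧
        (l : ℝ) ≤ 2 * (∑ q ∈ A, Real.log (q : ℝ)) + 8 * h + C := by
  obtain ⟨C, hC, H⟩ := lemma41_absolute 1 (show (0 : ℝ) < 1 / 6 by norm_num) (by norm_num)
  refine ⟨C, hC, fun h hh A => ?_⟩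
  obtain ⟨P, hPcard, hP⟩ := H h hh A
  obtain ⟨l, hl⟩ := Finset.card_pos.mp (by omega : 0 < P.card)
  obtain ⟨hprime, hnot, hhl, hle⟩ := hP l hl
  refine ⟨l, hprime, hnot, hhl, ?_⟩
  norm_num at hle
  linarith

end Literature.NumberTheory.DiophantineGeometry.GenEll

end
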